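import Summits.CriticalPhenomena.PercolationContinuityZ3.Theorems.PercNearOneGluingNoHeavyRsw3InvasionCanonicalEnd
import Summits.CriticalPhenomena.PercolationContinuityZ3.Theorems.PercNearOneGluingNoHeavyRsw3InvasionEquivariance
import HarnessLib

/-!
# RSW3 lane (P2, gen 30): THE WIRED MINIMAL SPANNING FOREST, I — `𝔉_w(U)` IS ACYCLIC (every label field), rays in forests, and
# **THE CANONICAL ORIENTATION OF `𝔉_w(ℤ^d)`**: a.s. the backbones are COHERENT (`R_{R_x(i)} = R_x(i + ·)`) and every WMSF bond `{v, w}` is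
# oriented EXACTLY ONE WAY (`R_v(1) = w` xor `R_w(1) = v`) — every vertex has a well-defined parent toward the canonical end

builds on p205010 (kernel theorem, internal audit signed; external expert review pending) — used only in §4 (through gen 29's a.s. backbones).

Cell `prim-rsw3`, prover seat `prim-rsw3-p2` (gen 30), memo `run/shared/lean/prim/rsw3/P2-RSWLITE.md` §37.  Support file
(`--supports stmt-CriticalPhenomena-4575`); no definitions, no named facts, no sorries.  First file of the programme "every component of
`𝔉_w(ℤ^d)` has EXACTLY ONE end" (Lyons–Peres 2016 Thm. 11.12 = Lyons–Peres–Schramm 2006 Thm. 3.12 in full; gen 29 proved its first paragraph —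
every invasion tree is one-ended — and the canonical end of each component).  `F = fromEdgeSet (wmsf G U)`, `T(x) = Invasion.tree G U x`,
`R_x` = the (a.s. unique) self-avoiding ray from `x` in `T(x)` (gen 29 files XXXV–XXXVII).

* §1 `wmsf_isAcyclic` — **`𝔉_w(U)` is a forest, for EVERY label field** (the bond of largest label on a cycle would be the strict minimum of a finite
  cut crossed at least twice by the cycle); `fromEdgeSet_wmsf_le`, `tree_le_fromEdgeSet_wmsf` (`T(x) ≤ F`, labels injective on bonds).
* §2 `ray_eq_of_tail_shared` — in an acyclic graph two self-avoiding rays from one vertex that share a tail COINCIDE.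
* §3 (every infinite connected locally finite graph, injective labels, outlets beyond every time and a backbone at every vertex — all a.s. on `ℤ^d`):
  **`ray_coherent`** (`R_{R_x(i)}(k) = R_x(i+k)`), **`parent_or_parent`** / `not_parent_and_parent` (across a WMSF bond exactly one endpoint is the
  other's parent `R_·(1)`), `parent_iff_of_mem_wmsf`.
* §4 `ae_wmsf_orientation` (`ℤ^d`, `d ≥ 2`): all of the above almost surely, simultaneously for all vertices.

References: R. Lyons, Y. Peres, O. Schramm, Ann. Probab. 34 (2006) §3, Thm. 3.12 [LyonsPeresSchramm2006]; R. Lyons, Y. Peres, *Probability on Trees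
and Networks* (2016) §11.1 (𝔉_w), Thm. 11.12 [LyonsPeres2016].
-/

noncomputable section

namespace Summit.CriticalPhenomena.PercolationContinuityZ3.Theorems.Rsw3

open Finset Filter MeasureTheory Literature.Probability.LatticeModels Literature.Probability.Percolation
open Literature.Probability.Percolation.Invasion

section General

variable {V : Type*} [DecidableEq V] {G : SimpleGraph V} [G.LocallyFinite]

/-! ## §1 `𝔉_w(U)` is a forest -/

/-- `𝔉_w(U)` is a subgraph of `G`. [cite: LyonsPeresSchramm2006, §3 (p. 1671)] -/
theorem fromEdgeSet_wmsf_le (U : Sym2 V → ℝ) : SimpleGraph.fromEdgeSet (wmsf G U) ≤ G := by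
  intro u v h
  rw [SimpleGraph.fromEdgeSet_adj] at h
  exact (SimpleGraph.mem_edgeSet G).1 (mem_edgeSet_of_mem_wmsf G h.1)

/-- Every invasion tree is a subgraph of `𝔉_w(U)` (labels injective on the bonds; gen 29 file XXXIV `treeEdges_subset_wmsf`).
[cite: LyonsPeresSchramm2006, Prop. 3.3] -/
theorem tree_le_fromEdgeSet_wmsf {U : Sym2 V → ℝ} (hU : Set.InjOn U G.edgeSet) (o : V) :
    tree G U o ≤ SimpleGraph.fromEdgeSet (wmsf G U) := by
  intro u v h
  rw [SimpleGraph.fromEdgeSet_adj]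
  obtain ⟨he, hne⟩ := (tree_adj G).1 h
  exact ⟨treeEdges_subset_wmsf hU o he, hne⟩

/-- **`𝔉_w(U)` IS ACYCLIC, for every label field** (every locally finite graph): on a cycle of WMSF bonds, the bond `e` of LARGEST label is, as a WMSF bond,
the STRICTLY smallest bond of some finite cut `∂W`; the rest of the cycle joins the two sides of `e` across `∂W`, so it contains another bond `e' ∈ ∂W`
with `U e < U e' ≤ U e`. [cite: LyonsPeres2016, §11.1 (minimal spanning forests are forests)] [cite: LyonsPeresSchramm2006, §3 (p. 1671)] -/
theorem wmsf_isAcyclic (U : Sym2 V → ℝ) : (SimpleGraph.fromEdgeSet (wmsf G U)).IsAcyclic := by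
  classical
  intro v c hc
  have hsub : ∀ e ∈ c.edges, e ∈ wmsf G U := fun e he => by
    have h := c.edges_subset_edgeSet he
    rw [SimpleGraph.edgeSet_fromEdgeSet] at h
    exact h.1
  -- the bond of the cycle with the largest label
  have hlen : 0 < c.edges.length := by
    rw [SimpleGraph.Walk.length_edges]
    have := hc.isCircuit.three_le_length
    omega
  obtain ⟨e₀, he₀⟩ := List.exists_mem_of_length_pos hlen
  obtain ⟨e, he, hmax⟩ := c.edges.toFinset.exists_max_image U ⟨e₀, List.mem_toFinset.2 he₀⟩
  rw [List.mem_toFinset] at he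
  obtain ⟨W, a, haW, rfl, hmin⟩ := (mem_wmsf G).1 (hsub _ he)
  -- the cycle, seen in the graph `H` spanned by its own bonds
  set H : SimpleGraph V := SimpleGraph.fromEdgeSet {f | f ∈ c.edges} with hH
  have hcH : ∀ f ∈ c.edges, f ∈ H.edgeSet := fun f hf => by
    rw [hH, SimpleGraph.edgeSet_fromEdgeSet]
    exact ⟨hf, SimpleGraph.not_isDiag_of_mem_edgeSet _ (c.edges_subset_edgeSet hf)⟩
  have hc' : (c.transfer H hcH).IsCycle := hc.transfer hcH
  have he' : s(a.1, a.2) ∈ (c.transfer H hcH).edges := by rw [SimpleGraph.Walk.edges_transfer]; exact he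
  obtain ⟨-, hreach⟩ := SimpleGraph.adj_and_reachable_delete_edges_iff_exists_cycle.2 ⟨_, _, hc', he'⟩
  have hle : H.deleteEdges {s(a.1, a.2)} ≤ G := by
    refine (SimpleGraph.deleteEdges_le _).trans ?_
    intro x y hxy
    rw [hH, SimpleGraph.fromEdgeSet_adj] at hxy
    exact (SimpleGraph.mem_edgeSet G).1 (mem_edgeSet_of_mem_wmsf G (hsub _ hxy.1))
  have ha1 : a.1 ∈ W := ((mem_boundaryDarts G).1 haW).1
  have ha2 : a.2 ∉ W := ((mem_boundaryDarts G).1 haW).2.1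
  obtain ⟨b, hbW, hbadj⟩ := exists_boundaryDart_of_reachable hle hreach ha1 ha2
  rw [SimpleGraph.deleteEdges_adj, hH, SimpleGraph.fromEdgeSet_adj] at hbadj
  obtain ⟨⟨hbc, -⟩, hbne⟩ := hbadj
  have hne : s(b.1, b.2) ≠ s(a.1, a.2) := fun h => hbne (by rw [h]; exact Set.mem_singleton _)
  have h1 : U s(a.1, a.2) < U s(b.1, b.2) := hmin b hbW hne
  have h2 : U s(b.1, b.2) ≤ U s(a.1, a.2) := hmax _ (List.mem_toFinset.2 hbc)
  exact absurd h1 (not_lt.2 h2)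

/-! ## §2 Rays in forests -/

omit [DecidableEq V] [G.LocallyFinite] in
/-- **In an acyclic graph, two self-avoiding rays from the same vertex that share a tail coincide** (they meet again beyond index `1`, so they agree at
index `1` by uniqueness of paths; shift and repeat). [cite: LyonsPeres2016, §11.1 (ends of a tree)] -/
theorem ray_eq_of_tail_shared {H : SimpleGraph V} (hH : H.IsAcyclic) (n : ℕ) :
    ∀ {r r' : ℕ → V}, Function.Injective r → Function.Injective r' →
      (∀ i, H.Adj (r i) (r (i + 1))) → (∀ i, H.Adj (r' i) (r' (i + 1))) → r 0 = r' 0 →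
      ∀ a b : ℕ, (∀ k, r (a + k) = r' (b + k)) → r n = r' n := by
  induction n with
  | zero => intro r r' _ _ _ _ h0 _ _ _; exact h0
  | succ n ih =>
    intro r r' hr hr' hadj hadj' h0 a b hab
    have h1 : r 1 = r' 1 :=
      eq_one_of_isAcyclic_of_meet hH hr hr' hadj hadj' h0 (i := a + 1) (i' := b + 1) (by omega) (by omega) (hab 1)
    have h := ih (r := fun k => r (k + 1)) (r' := fun k => r' (k + 1)) (fun i j hij => by simpa using hr hij)
      (fun i j hij => by simpa using hr' hij) (fun i => hadj (i + 1)) (fun i => hadj' (i + 1)) h1 a b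
      (fun k => by rw [Nat.add_assoc a k 1, Nat.add_assoc b k 1]; exact hab (k + 1))
    simpa using h

omit [DecidableEq V] [G.LocallyFinite] in
/-- Function form of `ray_eq_of_tail_shared`. [cite: LyonsPeres2016, §11.1 (ends of a tree)] -/
theorem ray_eq_of_tail_shared' {H : SimpleGraph V} (hH : H.IsAcyclic) {r r' : ℕ → V} (hr : Function.Injective r) (hr' : Function.Injective r')
    (hadj : ∀ i, H.Adj (r i) (r (i + 1))) (hadj' : ∀ i, H.Adj (r' i) (r' (i + 1))) (h0 : r 0 = r' 0)
    (htail : ∃ a b, ∀ k, r (a + k) = r' (b + k)) : r = r' := by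
  obtain ⟨a, b, hab⟩ := htail
  exact funext fun n => ray_eq_of_tail_shared hH n hr hr' hadj hadj' h0 a b hab

/-! ## §3 Coherence of the backbones and the orientation of WMSF bonds -/

/-- **COHERENCE OF THE BACKBONES**: if `R_x` is the backbone from `x` (a self-avoiding ray of `T(x)` from `x`) and `R'` the backbone from the vertex `R_x(i)`, then
`R'(k) = R_x(i + k)` for all `k` — the backbone of a backbone vertex is the tail of the backbone (both are rays of the FOREST `𝔉_w ⊇ T(·)` from `R_x(i)`
sharing a tail by the canonical end, gen 29 file XXXIX).  Hypotheses (all a.s. on `ℤ^d`): infinite connected locally finite graph, injective labels, outlets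
beyond every time and a backbone at every vertex. [cite: LyonsPeresSchramm2006, Thm. 3.12 (proof: the special end)] -/
theorem ray_coherent [Infinite V] (hG : G.Preconnected) {U : Sym2 V → ℝ} (hU : Function.Injective U)
    (hout : ∀ v : V, ∀ k, ∃ m, k ≤ m ∧ IsOutlet G U v m)
    (hray : ∀ v : V, ∃ R : ℕ → V, Function.Injective R ∧ R 0 = v ∧ ∀ i, (tree G U v).Adj (R i) (R (i + 1)))
    {x : V} {Rx : ℕ → V} (hRx : Function.Injective Rx) (hRx0 : Rx 0 = x) (hRxadj : ∀ i, (tree G U x).Adj (Rx i) (Rx (i + 1)))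
    (i : ℕ) {R' : ℕ → V} (hR' : Function.Injective R') (hR'0 : R' 0 = Rx i) (hR'adj : ∀ j, (tree G U (Rx i)).Adj (R' j) (R' (j + 1))) :
    ∀ k, R' k = Rx (i + k) := by
  have hUi : Set.InjOn U G.edgeSet := hU.injOn
  have hreach : (SimpleGraph.fromEdgeSet (wmsf G U)).Reachable x (Rx i) := by
    obtain ⟨p, -⟩ := exists_walk_support_eq Rx hRxadj i
    rw [← hRx0]
    exact ⟨p.transfer _ fun e he => (SimpleGraph.edgeSet_mono (tree_le_fromEdgeSet_wmsf hUi x)) (p.edges_subset_edgeSet he)⟩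
  obtain ⟨a, b, hab⟩ := rays_tail_equivalent_of_wmsf_reachable hG hU hout hray hreach hRx hRx0 hRxadj hR' hR'0 hR'adj
  have htail : ∃ a' b', ∀ k, R' (a' + k) = Rx (i + (b' + k)) := by
    rcases le_or_gt i a with hia | hia
    · refine ⟨b, a - i, fun k => ?_⟩
      rw [← hab k, show i + (a - i + k) = a + k by omega]
    · refine ⟨b + (i - a), 0, fun k => ?_⟩
      have h := hab (i - a + k)
      rw [show a + (i - a + k) = i + (0 + k) by omega] at h
      rw [show b + (i - a) + k = b + (i - a + k) by omega, ← h]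
  have h := ray_eq_of_tail_shared' (wmsf_isAcyclic U) (r := R') (r' := fun k => Rx (i + k)) hR'
    (fun j k hjk => by simpa using hRx hjk) (fun j => tree_le_fromEdgeSet_wmsf hUi _ (hR'adj j))
    (fun j => tree_le_fromEdgeSet_wmsf hUi _ (by simpa [Nat.add_assoc] using hRxadj (i + j))) (by simpa using hR'0) htail
  exact fun k => congrFun h k

/-- **ORIENTATION OF A WMSF BOND**: across a bond `s(v, w) ∈ 𝔉_w(U)`, one endpoint is the other's parent: `R_v(1) = w` or `R_w(1) = v` (if `v` is not on
`R_w`, then `v, R_w(0), R_w(1), …` is a forest ray from `v` sharing a tail with `R_v`, hence equal to it; if `v = R_w(i)` then `i = 1` by uniqueness of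
paths in the forest). [cite: LyonsPeresSchramm2006, Thm. 3.12 (proof: the trunk oriented toward the special end)] [cite: LyonsPeres2016, Thm. 11.12 (proof)] -/
theorem parent_or_parent [Infinite V] (hG : G.Preconnected) {U : Sym2 V → ℝ} (hU : Function.Injective U)
    (hout : ∀ v : V, ∀ k, ∃ m, k ≤ m ∧ IsOutlet G U v m)
    {v w : V} (he : s(v, w) ∈ wmsf G U)
    {Rv : ℕ → V} (hRv : Function.Injective Rv) (hRv0 : Rv 0 = v) (hRvadj : ∀ i, (tree G U v).Adj (Rv i) (Rv (i + 1)))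
    {Rw : ℕ → V} (hRw : Function.Injective Rw) (hRw0 : Rw 0 = w) (hRwadj : ∀ i, (tree G U w).Adj (Rw i) (Rw (i + 1))) :
    Rv 1 = w ∨ Rw 1 = v := by
  classical
  have hUi : Set.InjOn U G.edgeSet := hU.injOn
  set F := SimpleGraph.fromEdgeSet (wmsf G U) with hF
  have hvw : v ≠ w := ((SimpleGraph.mem_edgeSet G).1 (mem_edgeSet_of_mem_wmsf G he)).ne
  have hFadj : F.Adj v w := (SimpleGraph.fromEdgeSet_adj _).2 ⟨he, hvw⟩
  by_cases hv : ∃ i, Rw i = v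
  · obtain ⟨i, hi⟩ := hv
    right
    have hi0 : i ≠ 0 := fun h => hvw (by rw [h, hRw0] at hi; exact hi.symm)
    -- the forest path `w = R_w 0, …, R_w i = v` versus the bond `{w, v}`
    obtain ⟨p, hp⟩ := exists_walk_support_eq Rw hRwadj i
    let pF : F.Walk w v := (p.transfer F fun e he' =>
      (SimpleGraph.edgeSet_mono (tree_le_fromEdgeSet_wmsf hUi w)) (p.edges_subset_edgeSet he')).copy hRw0 hi
    have hpF : pF.IsPath := by
      rw [SimpleGraph.Walk.isPath_def, SimpleGraph.Walk.support_copy, SimpleGraph.Walk.support_transfer, hp]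
      exact (List.nodup_range).map hRw
    let q : F.Walk w v := SimpleGraph.Walk.cons hFadj.symm SimpleGraph.Walk.nil
    have hq : q.IsPath :=
      SimpleGraph.Walk.IsPath.nil.cons (by rw [SimpleGraph.Walk.support_nil, List.mem_singleton]; exact hvw.symm)
    have hpq : (⟨pF, hpF⟩ : F.Path w v) = ⟨q, hq⟩ := (wmsf_isAcyclic U).path_unique _ _
    have hlen : pF.length = q.length := by rw [show pF = q from congrArg Subtype.val hpq]
    have hi1 : i = 1 := by
      have h1 : pF.length = i := by
        rw [SimpleGraph.Walk.length_copy, SimpleGraph.Walk.length_transfer]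
        have := congrArg List.length hp
        rw [SimpleGraph.Walk.length_support, List.length_map, List.length_range] at this
        omega
      have h2 : q.length = 1 := rfl
      omega
    rw [hi1] at hi
    exact hi
  · left
    have hv' : ∀ i, Rw i ≠ v := fun i h => hv ⟨i, h⟩
    -- the ray `v, R_w 0, R_w 1, …` from `v` in the forest
    let σ : ℕ → V := fun k => Nat.casesOn k v fun j => Rw j
    have hσ0 : σ 0 = v := rfl
    have hσs : ∀ j, σ (j + 1) = Rw j := fun j => rfl
    have hσinj : Function.Injective σ := by
      intro i j hij
      cases i with
      | zero =>
        cases j with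
        | zero => rfl
        | succ j => exact absurd (hij.symm.trans hσ0) (hv' j)
      | succ i =>
        cases j with
        | zero => exact absurd (hij.trans hσ0) (hv' i)
        | succ j => rw [hσs, hσs] at hij; rw [hRw hij]
    have hσadj : ∀ k, F.Adj (σ k) (σ (k + 1)) := by
      intro k
      cases k with
      | zero => rw [hσ0, hσs, hRw0]; exact hFadj
      | succ j => rw [hσs, hσs]; exact tree_le_fromEdgeSet_wmsf hUi w (hRwadj j)
    obtain ⟨a, b, hab⟩ := rays_tail_equivalent_of_mem_wmsf hG hU he (hout v) hRv hRv0 hRvadj hRw hRwadj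
    have h := ray_eq_of_tail_shared (wmsf_isAcyclic U) 1 hσinj hRv hσadj (fun i => tree_le_fromEdgeSet_wmsf hUi v (hRvadj i))
      (hσ0.trans hRv0.symm) (b + 1) a (fun k => by rw [show b + 1 + k = (b + k) + 1 by omega, hσs, hab k])
    rw [show σ 1 = Rw 0 from rfl, hRw0] at h
    exact h.symm

/-- **… and not both**: `R_v(1) = w` and `R_w(1) = v` cannot hold simultaneously (coherence would give `R_v(2) = R_w(1) = v = R_v(0)`).
[cite: LyonsPeresSchramm2006, Thm. 3.12 (proof)] -/
theorem not_parent_and_parent [Infinite V] (hG : G.Preconnected) {U : Sym2 V → ℝ} (hU : Function.Injective U)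
    (hout : ∀ v : V, ∀ k, ∃ m, k ≤ m ∧ IsOutlet G U v m)
    (hray : ∀ v : V, ∃ R : ℕ → V, Function.Injective R ∧ R 0 = v ∧ ∀ i, (tree G U v).Adj (R i) (R (i + 1)))
    {v w : V} {Rv : ℕ → V} (hRv : Function.Injective Rv) (hRv0 : Rv 0 = v) (hRvadj : ∀ i, (tree G U v).Adj (Rv i) (Rv (i + 1)))
    {Rw : ℕ → V} (hRw : Function.Injective Rw) (hRw0 : Rw 0 = w) (hRwadj : ∀ i, (tree G U w).Adj (Rw i) (Rw (i + 1))) :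
    ¬ (Rv 1 = w ∧ Rw 1 = v) := by
  rintro ⟨h1, h2⟩
  have hcoh := ray_coherent hG hU hout hray hRv hRv0 hRvadj 1 hRw (hRw0.trans h1.symm) (by rw [h1]; exact hRwadj)
  have : Rv (1 + 1) = Rv 0 := by rw [← hcoh 1, h2, hRv0]
  exact absurd (hRv this) (by omega)

/-- **The parent relation across a WMSF bond, as an iff**: for `s(v, w) ∈ 𝔉_w(U)`, `R_v(1) = w ⟺ R_w(1) ≠ v`. [cite: LyonsPeresSchramm2006, Thm. 3.12 (proof)] -/
theorem parent_iff_of_mem_wmsf [Infinite V] (hG : G.Preconnected) {U : Sym2 V → ℝ} (hU : Function.Injective U)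
    (hout : ∀ v : V, ∀ k, ∃ m, k ≤ m ∧ IsOutlet G U v m)
    (hray : ∀ v : V, ∃ R : ℕ → V, Function.Injective R ∧ R 0 = v ∧ ∀ i, (tree G U v).Adj (R i) (R (i + 1)))
    {v w : V} (he : s(v, w) ∈ wmsf G U)
    {Rv : ℕ → V} (hRv : Function.Injective Rv) (hRv0 : Rv 0 = v) (hRvadj : ∀ i, (tree G U v).Adj (Rv i) (Rv (i + 1)))
    {Rw : ℕ → V} (hRw : Function.Injective Rw) (hRw0 : Rw 0 = w) (hRwadj : ∀ i, (tree G U w).Adj (Rw i) (Rw (i + 1))) :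
    Rv 1 = w ↔ Rw 1 ≠ v := by
  have h1 := parent_or_parent hG hU hout he hRv hRv0 hRvadj hRw hRw0 hRwadj
  have h2 := not_parent_and_parent hG hU hout hray hRv hRv0 hRvadj hRw hRw0 hRwadj
  tauto

/-- **The parent is a forest neighbour and the backbone climbs through parents**: `s(R_x(i), R_x(i+1)) ∈ 𝔉_w(U)` and `R_x(i+1) = R_{R_x(i)}(1)` for every `i`.
[cite: LyonsPeresSchramm2006, Thm. 3.12 (proof)] -/
theorem ray_succ_eq_parent [Infinite V] (hG : G.Preconnected) {U : Sym2 V → ℝ} (hU : Function.Injective U)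
    (hout : ∀ v : V, ∀ k, ∃ m, k ≤ m ∧ IsOutlet G U v m)
    (hray : ∀ v : V, ∃ R : ℕ → V, Function.Injective R ∧ R 0 = v ∧ ∀ i, (tree G U v).Adj (R i) (R (i + 1)))
    {x : V} {Rx : ℕ → V} (hRx : Function.Injective Rx) (hRx0 : Rx 0 = x) (hRxadj : ∀ i, (tree G U x).Adj (Rx i) (Rx (i + 1)))
    (i : ℕ) {R' : ℕ → V} (hR' : Function.Injective R') (hR'0 : R' 0 = Rx i) (hR'adj : ∀ j, (tree G U (Rx i)).Adj (R' j) (R' (j + 1))) :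
    s(Rx i, Rx (i + 1)) ∈ wmsf G U ∧ R' 1 = Rx (i + 1) :=
  ⟨treeEdges_subset_wmsf hU.injOn x ((tree_adj G).1 (hRxadj i)).1, ray_coherent hG hU hout hray hRx hRx0 hRxadj i hR' hR'0 hR'adj 1⟩

end General

/-! ## §4 `ℤ^d`: the orientation of `𝔉_w(ℤ^d)`, almost surely -/

variable {d : ℕ}

/-- **THE CANONICAL ORIENTATION OF THE WMSF OF `ℤ^d`** (`d ≥ 2`, p205010 through gen 29's backbones): almost surely — (i) `𝔉_w(U)` is acyclic; (ii) for every
`x` and its backbone `R_x` (the unique self-avoiding ray from `x` in `T(x)`), the backbone from `R_x(i)` is `R_x(i + ·)` (COHERENCE); (iii) for every WMSF bond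
`s(v, w)`, EXACTLY ONE of `R_v(1) = w`, `R_w(1) = v` holds (every bond points from a child to its parent).
[cite: LyonsPeresSchramm2006, Thm. 3.12 (proof)] [cite: LyonsPeres2016, Thm. 11.12 (proof: "oriented toward the special end")] -/
theorem ae_wmsf_orientation (hd : 2 ≤ d) :
    ∀ᵐ U ∂(labelMeasure (Site d)),
      (SimpleGraph.fromEdgeSet (wmsf (zdGraph d) U)).IsAcyclic ∧
      (∀ x : Site d, ∀ Rx : ℕ → Site d, Function.Injective Rx → Rx 0 = x → (∀ i, (tree (zdGraph d) U x).Adj (Rx i) (Rx (i + 1))) →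
        ∀ i : ℕ, ∀ R' : ℕ → Site d, Function.Injective R' → R' 0 = Rx i → (∀ j, (tree (zdGraph d) U (Rx i)).Adj (R' j) (R' (j + 1))) →
          ∀ k, R' k = Rx (i + k)) ∧
      ∀ v w : Site d, s(v, w) ∈ wmsf (zdGraph d) U →
        ∀ Rv Rw : ℕ → Site d, Function.Injective Rv → Rv 0 = v → (∀ i, (tree (zdGraph d) U v).Adj (Rv i) (Rv (i + 1))) →
          Function.Injective Rw → Rw 0 = w → (∀ i, (tree (zdGraph d) U w).Adj (Rw i) (Rw (i + 1))) →
            (Rv 1 = w ∨ Rw 1 = v) ∧ ¬ (Rv 1 = w ∧ Rw 1 = v) := by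
  haveI : Nonempty (Fin d) := ⟨⟨0, by omega⟩⟩
  haveI : Infinite (Site d) := Pi.infinite_of_right
  filter_upwards [Literature.Barriers.CriticalPhenomena.ae_injective_labelMeasure (V := Site d), ae_forall_root_existsUnique_ray hd]
    with U hU hall
  have hout : ∀ v : Site d, ∀ k, ∃ m, k ≤ m ∧ IsOutlet (zdGraph d) U v m := fun v => (hall v).1
  have hray : ∀ v : Site d, ∃ R : ℕ → Site d, Function.Injective R ∧ R 0 = v ∧ ∀ i, (tree (zdGraph d) U v).Adj (R i) (R (i + 1)) :=
    fun v => (hall v).2.exists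
  refine ⟨wmsf_isAcyclic U, fun x Rx hRx hRx0 hRxadj i R' hR' hR'0 hR'adj =>
    ray_coherent zdGraph_preconnected_holds hU hout hray hRx hRx0 hRxadj i hR' hR'0 hR'adj, ?_⟩
  intro v w he Rv Rw hRv hRv0 hRvadj hRw hRw0 hRwadj
  exact ⟨parent_or_parent zdGraph_preconnected_holds hU hout he hRv hRv0 hRvadj hRw hRw0 hRwadj,
    not_parent_and_parent zdGraph_preconnected_holds hU hout hray hRv hRv0 hRvadj hRw hRw0 hRwadj⟩

end Summit.CriticalPhenomena.PercolationContinuityZ3.Theorems.Rsw3
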